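import Summits.QuantumFields.YangMills.Theorems.BalabanUVNodesN13Cor3AEKeepZeroOfEnginesRowAtRecord13
import Literature.MathematicalPhysics.QuantumFieldTheory.Balaban1983to89.Node00.Record13SepCoPHChi

/-!
# BalabanUVNodes ∕ N13 → K1ᴬ — THE χ-GENERIC EDITION OF THE (B)-SLOT's KEEP-ZERO SUPPLIER: Theorem 1 at the χ-generic datum + the engines' N13 row (level 0 at every field,
# levels ≥ 1 `dV`-a.e.) ⟹ `∃ v : Revision₁₃Chi θ χ h, B16.EndStatementBPrinted (datumOfRecord₁₃SepCoPHVChi θ χ h v).C` — dag-n13-w3's `…N13Cor3AEKeepZeroOfEnginesRowAtRecord13` §2∕§4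
# (+ the §2 record rows of `…N13Cor3AEIffUpToVersionAtRecord13` and node00 DEF-1's version-slot adapters of `Node00/Record13SepCoPHV`) with the record's β-slot small-field function a
# FIXED parameter `(χ : ChiSlot F N)`, and the Ax instances at `χ := chiβOfRecord₁₃Ax F N θ.toStage13Params` (WORK ORDER RC-1, director-ym №462 (B) ∕ №467 (D); K1ᴬ stmt-QuantumFields-27239)

TRACK A (YM-PLAN §2d), node N13's hand-off to the COMPOSITE N24; seat `pub-ymgap-dag-n24-c` g23 (op 5b ENGINE-LANE HAND; dag-lead HANDS-3 (iv) precedent: no live N13 seat, the consumer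
types the Ax edition; `--kind proof --supports stmt-QuantumFields-27239 --as helper`, count-neutral).

WHY.  The K1 engine of record (`…AtAbstractWitnessY0` §2, cofinal ENGINE ✓p782234) reads N13 in the a.e. currency through ONE name,
`N13Cor3AEKeepZeroOfEnginesRowAtRecord13.exists_revision₁₃_endStatementBPrinted_of_thm1_of_row0_of_aeRowSucc` (keyed on the CHOICE-centred datum `datumOfRecord₁₃SepCoPH`, cut-off
`chiβOfRecord₁₃`, densities `densOfRecord₁₃`, slot `Revision₁₃`); the K1ᴬ engine needs the same sentence at the RE-CENTRED record (`datumOfRecord₁₃SepCoPHVAx`, `Revision₁₃Ax`, decl-level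
census `ConeCensusK1.lean`, pub-ymgap INBOX I.22228).  The parent's analytic core is already CENTRE-FREE — its §1 `exists_rho_keep0_ae_eq_endStatementBPrinted_construction_of_thm1_of_ae` is
stated for ANY `RGMachineCore` with `χ ≤ 1`, `0 ≤ A^η` — so the χ edition is bookkeeping: instantiate it at the χ-generic core `coreOfRecord₁₃CoPHChi θ χ` over `densOfRecord₁₃Chi`
(`datumOfRecord₁₃SepCoPH_C_chi`, `rfl`), with the ONE genuinely χ-dependent input made a HYPOTHESIS `hχ1 : ∀ K g k V, χ K g k V ≤ 1` (at the record's two centres it is `chiFix29(Ax)OfRecord ∈ {0,1}`).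

WHAT IS HERE (theorems only; 0 `def`, 0 `sorry`, standard axioms):
* §1χ `signs_datum_chi` (`χ ≤ 1` from `hχ1`, `0 ≤ A^η` by `wilsonBGOfRecord_nonneg`) · `uvIneq_at_record₁₃SepCoPH_iff_chi` ((2.50) at the χ-datum IS the record-letters bound, `Iff.rfl`) ·
  ★ `exists_rho_keep0_ae_eq_endStatementBPrinted_record_of_thm1_of_row0_of_aeRowSucc_chi` · `…succGuarded…_chi` (the parent's §2 over the χ-generic core).
* §2χ the version-slot adapters at χ (node00 DEF-1's `Record13SepCoPHV` :337∕:348 VERBATIM over `[Ax-3d]`'s `Revision₁₃Chi ∕ datumOfRecord₁₃SepCoPHVChi`):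
  `exists_revision₁₃Chi_of_exists_update` · `exists_revision₁₃Chi_endStatementBPrinted_of_exists_update` · ★★ `exists_revision₁₃_endStatementBPrinted_of_thm1_of_row0_of_aeRowSucc_chi`.
* §3Ax `chiβOfRecord₁₃Ax_le_one` (`[Ax-2]`'s `chiFixed29Ax_eq_zero_or_one`) · ★★★ `exists_revision₁₃Ax_endStatementBPrinted_of_thm1_of_row0_of_aeRowSucc` — the K1ᴬ engine's N13 name: Theorem 1 at
  `datumOfRecord₁₃SepCoPHAx θ h` + the row over `chiβOfRecord₁₃Ax ∕ gOfRecord₁₃Chi … (chiβOfRecord₁₃Ax …) ∕ densOfRecord₁₃Chi … (chiβOfRecord₁₃Ax …)` ⟹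
  `∃ v : Revision₁₃Ax F N θ h, B16.EndStatementBPrinted (datumOfRecord₁₃SepCoPHVAx F N θ h v).C`.

HONEST FRAMING.  Bookkeeping re-issue; the N13 row (2.50) is a DISPLAYED HYPOTHESIS in the a.e. currency, inhabited at no θ here; N13 NOT discharged; nothing of Bałaban asserted; K1ᴬ DECIDING ∕
OPEN, not claimed; counts unmoved (discharged 8∕27 · K 1∕4); one finite 𝕋⁴ programme at fixed ε = L^{−K} — NOT continuum ∕ ℝ⁴ ∕ OS ∕ mass gap ∕ Clay.  No `def`, no `instance`, no `sorry`.
References (context): [V] = [Balaban1989LargeFieldII] Thm 1 + (0.1) pp.355–356, p.391; [III] = [Balaban1988Convergent] Thm 1 p.262, (0.2) p.244, (2.18) p.257, Cor. 3 (2.50) p.264;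
[I] = [Balaban1987RG1] (2.9) p.266 with (2.3) p.265, (0.2) p.252; [14] = [Balaban1988RG2Cluster] (2.5)∕(2.9) (the re-centred cut-off).
-/

noncomputable section

open scoped ENNReal

namespace Summit.QuantumFields.YangMills.BalabanUVNodes.N13Cor3AEKeepZeroOfEnginesRowAtRecord13Chi

open MeasureTheory Set
open Literature.MathematicalPhysics.QuantumFieldTheory.Balaban1983to89
open Literature.MathematicalPhysics.QuantumFieldTheory.Balaban1983to89.T4Continuum (T4Family)
open Literature.MathematicalPhysics.QuantumFieldTheory.Balaban1983to89.Node00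
open Summit.QuantumFields.YangMills.BalabanUVNodes.N13Cor3AEIffUpToVersionAtRecord13 (exists_rho_eqOn_endStatementBPrinted_of_thm1_of_offSet)
open Summit.QuantumFields.YangMills.BalabanUVNodes.N13Cor3AEKeepZeroOfEnginesRowAtRecord13 (exists_rho_keep0_ae_eq_endStatementBPrinted_construction_of_thm1_of_ae)
open T4DatumAssembly FlowStepRuns

/-! ## §1χ. At the χ-generic Stage-13 record, in the engines' letters (level 0 at every field, levels ≥ 1 `dV`-a.e.) -/

section RecordChi

variable (F : T4Family) (N : ℕ) [NeZero N] (θ : Stage13HParams F N) (χ : ChiSlot F N) (h : θ.Provisos₁₃SepCoPHChi F N χ)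

/-- The sign faces of the χ-generic datum's construction: `χ_k ≤ 1` (HYPOTHESIS `hχ1` on the β-slot cut-off — at both centres of record it is a `{0,1}`-valued species) and
`0 ≤ A^η(U_k(V))` (`wilsonBGOfRecord_nonneg`). [cite: Balaban1987RG1, (2.9) p.266, (0.2) p.252 (bookkeeping)] -/
theorem signs_datum_chi (hχ1 : ∀ (K : ℕ) (g : ℕ → ℝ) (k : ℕ) (V : GaugeField (F.P K) k (SU N)), χ K g k V ≤ 1) (P : B12.RunParams) (k : ℕ)
    (V : ((datumOfRecord₁₃SepCoPHChi F N θ χ h).C P).Cfg k) :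
    ((datumOfRecord₁₃SepCoPHChi F N θ χ h).C P).χ k V ≤ 1 ∧ 0 ≤ ((datumOfRecord₁₃SepCoPHChi F N θ χ h).C P).wilsonBG k V :=
  ⟨hχ1 P.K _ k V, wilsonBGOfRecord_nonneg F N θ.εbg P k V⟩

/-- **(2.50) at the χ-generic datum IS the record-letters two-sided bound** (`Iff.rfl` through `datumOfRecord₁₃SepCoPH_C_chi` ∕ `RGMachineCore.construction`): `χ_k = χ K (g) k`,
`A^η_k = wilsonBGOfRecord … θ.εbg`, `g_k = gOfRecord₁₃Chi`, `ρ_k = densOfRecord₁₃Chi`, `|T₁^{(k)}| = |Site (F.P P.K) k|`. [cite: Balaban1989LargeFieldII, (0.1) pp.355–356; Balaban1988Convergent, (2.50) p.264 (bookkeeping)] -/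
theorem uvIneq_at_record₁₃SepCoPH_iff_chi (P : B12.RunParams) (k : ℕ) (V : GaugeField (F.P P.K) k (SU N)) (Em Ep : ℝ) :
    B16.UVIneq ((datumOfRecord₁₃SepCoPHChi F N θ χ h).C P) k V Em Ep ↔
      χ P.K (gOfRecord₁₃Chi F N θ.toStage13Params χ P) k V *
            Real.exp (-(1 / (gOfRecord₁₃Chi F N θ.toStage13Params χ P k) ^ 2 * wilsonBGOfRecord F N θ.εbg P k V) - Em * (Fintype.card (Site (F.P P.K) k) : ℝ)) ≤
          densOfRecord₁₃Chi F N θ.toStage13Params χ P k V ∧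
        densOfRecord₁₃Chi F N θ.toStage13Params χ P k V ≤ Real.exp (Ep * (Fintype.card (Site (F.P P.K) k) : ℝ)) :=
  Iff.rfl

/-- **★ THE (δⱽ) SLOT's SUPPLIER SHAPE AT THE χ-GENERIC RECORD, LEVEL 0 KEPT** (the parent's §2 over the χ-generic core `coreOfRecord₁₃CoPHChi θ χ`, `(datum).C = construction densOfRecord₁₃Chi`,
`rfl`): Theorem 1 at the χ-datum + the engines' N13 row (window `γ`, guard `SLaw₁₃CoPHChi`, `em`∕`ep` of `g_k`) with «every `U`» at level 0 and «`dV`-a.e. `U`» at levels `k+1` ⟹ densities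
`ρ′` equal to `densOfRecord₁₃Chi θ χ P 0` at level 0 and `=ᵐ[dV]` at every level, with `B16.EndStatementBPrinted (fun P => {(datum).C P with ρ := ρ′ P})` AS TYPED.
[cite: Balaban1989LargeFieldII, Thm 1 + (0.1) pp.355–356; Balaban1988Convergent, Thm 1 p.262, (0.2) p.244, Cor. 3 (2.50) p.264 (bookkeeping)] -/
theorem exists_rho_keep0_ae_eq_endStatementBPrinted_record_of_thm1_of_row0_of_aeRowSucc_chi
    (hχ1 : ∀ (K : ℕ) (g : ℕ → ℝ) (k : ℕ) (V : GaugeField (F.P K) k (SU N)), χ K g k V ≤ 1)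
    (h1 : B16.Thm1Printed (datumOfRecord₁₃SepCoPHChi F N θ χ h).C) {γ : ℝ} (hγ : 0 < γ) {em ep : ℝ → ℝ}
    (hrow0 : ∀ P : B12.RunParams, ((datumOfRecord₁₃SepCoPHChi F N θ χ h).C P).flow.InInterval γ P.K → SLaw₁₃CoPHChi F N θ χ P 0 →
      ∀ U : GaugeField (F.P P.K) 0 (SU N),
        χ P.K (gOfRecord₁₃Chi F N θ.toStage13Params χ P) 0 U *
              Real.exp (-(1 / (gOfRecord₁₃Chi F N θ.toStage13Params χ P 0) ^ 2 * wilsonBGOfRecord F N θ.εbg P 0 U)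
                - em (gOfRecord₁₃Chi F N θ.toStage13Params χ P 0) * (Fintype.card (Site (F.P P.K) 0) : ℝ)) ≤ densOfRecord₁₃Chi F N θ.toStage13Params χ P 0 U ∧
          densOfRecord₁₃Chi F N θ.toStage13Params χ P 0 U ≤ Real.exp (ep (gOfRecord₁₃Chi F N θ.toStage13Params χ P 0) * (Fintype.card (Site (F.P P.K) 0) : ℝ)))
    (hrow : ∀ P : B12.RunParams, ((datumOfRecord₁₃SepCoPHChi F N θ χ h).C P).flow.InInterval γ P.K → ∀ k, k + 1 ≤ P.K → SLaw₁₃CoPHChi F N θ χ P (k + 1) →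
      ∀ᵐ U ∂(fieldMeasure (F.P P.K) (k + 1) (SU N)),
        χ P.K (gOfRecord₁₃Chi F N θ.toStage13Params χ P) (k + 1) U *
              Real.exp (-(1 / (gOfRecord₁₃Chi F N θ.toStage13Params χ P (k + 1)) ^ 2 * wilsonBGOfRecord F N θ.εbg P (k + 1) U)
                - em (gOfRecord₁₃Chi F N θ.toStage13Params χ P (k + 1)) * (Fintype.card (Site (F.P P.K) (k + 1)) : ℝ)) ≤ densOfRecord₁₃Chi F N θ.toStage13Params χ P (k + 1) U ∧
          densOfRecord₁₃Chi F N θ.toStage13Params χ P (k + 1) U ≤ Real.exp (ep (gOfRecord₁₃Chi F N θ.toStage13Params χ P (k + 1)) * (Fintype.card (Site (F.P P.K) (k + 1)) : ℝ))) :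
    ∃ ρ' : (P : B12.RunParams) → (k : ℕ) → GaugeField (F.P P.K) k (SU N) → ℝ,
      (∀ P, ρ' P 0 = densOfRecord₁₃Chi F N θ.toStage13Params χ P 0) ∧
        (∀ P k, ρ' P k =ᵐ[fieldMeasure (F.P P.K) k (SU N)] densOfRecord₁₃Chi F N θ.toStage13Params χ P k) ∧
        B16.EndStatementBPrinted (fun P => { (datumOfRecord₁₃SepCoPHChi F N θ χ h).C P with ρ := ρ' P }) := by
  obtain ⟨γ₁, hγ₁, hS⟩ := h1
  have hI : ∀ P : B12.RunParams, ((datumOfRecord₁₃SepCoPHChi F N θ χ h).C P).flow.InInterval (min γ γ₁) P.K →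
      ((datumOfRecord₁₃SepCoPHChi F N θ χ h).C P).flow.InInterval γ P.K ∧ ((datumOfRecord₁₃SepCoPHChi F N θ χ h).C P).flow.InInterval γ₁ P.K := fun P hP =>
    ⟨fun j hj => ⟨(hP j hj).1, (hP j hj).2.trans (min_le_left _ _)⟩, fun j hj => ⟨(hP j hj).1, (hP j hj).2.trans (min_le_right _ _)⟩⟩
  exact exists_rho_keep0_ae_eq_endStatementBPrinted_construction_of_thm1_of_ae (coreOfRecord₁₃CoPHChi F N θ χ) (densOfRecord₁₃Chi F N θ.toStage13Params χ)
    (fun P k V => (signs_datum_chi F N θ χ h hχ1 P k V).1) (fun P k V => (signs_datum_chi F N θ χ h hχ1 P k V).2) ⟨γ₁, hγ₁, hS⟩ (lt_min hγ hγ₁) (em := em) (ep := ep)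
    (fun P hP V => (uvIneq_at_record₁₃SepCoPH_iff_chi F N θ χ h P 0 V _ _).mpr (hrow0 P (hI P hP).1 (hS P (hI P hP).2 0 (Nat.zero_le _)) V))
    (fun P hP k hk => by
      filter_upwards [hrow P (hI P hP).1 k hk (hS P (hI P hP).2 (k + 1) hk)] with U hU
      exact (uvIneq_at_record₁₃SepCoPH_iff_chi F N θ χ h P (k + 1) U _ _).mpr hU)

/-- **The same with the a.e. clause in DEF-1's GUARDED SUCCESSOR letter** `∀ P k, k < P.K → ρ′ P (k+1) =ᵐ[dV] ρ_{k+1}`. [cite: Balaban1988Convergent, (0.2) p.244, Cor. 3 (2.50) p.264 (bookkeeping)] -/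
theorem exists_rho_keep0_ae_eq_succGuarded_endStatementBPrinted_record_of_thm1_of_row0_of_aeRowSucc_chi
    (hχ1 : ∀ (K : ℕ) (g : ℕ → ℝ) (k : ℕ) (V : GaugeField (F.P K) k (SU N)), χ K g k V ≤ 1)
    (h1 : B16.Thm1Printed (datumOfRecord₁₃SepCoPHChi F N θ χ h).C) {γ : ℝ} (hγ : 0 < γ) {em ep : ℝ → ℝ}
    (hrow0 : ∀ P : B12.RunParams, ((datumOfRecord₁₃SepCoPHChi F N θ χ h).C P).flow.InInterval γ P.K → SLaw₁₃CoPHChi F N θ χ P 0 →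
      ∀ U : GaugeField (F.P P.K) 0 (SU N),
        χ P.K (gOfRecord₁₃Chi F N θ.toStage13Params χ P) 0 U *
              Real.exp (-(1 / (gOfRecord₁₃Chi F N θ.toStage13Params χ P 0) ^ 2 * wilsonBGOfRecord F N θ.εbg P 0 U)
                - em (gOfRecord₁₃Chi F N θ.toStage13Params χ P 0) * (Fintype.card (Site (F.P P.K) 0) : ℝ)) ≤ densOfRecord₁₃Chi F N θ.toStage13Params χ P 0 U ∧
          densOfRecord₁₃Chi F N θ.toStage13Params χ P 0 U ≤ Real.exp (ep (gOfRecord₁₃Chi F N θ.toStage13Params χ P 0) * (Fintype.card (Site (F.P P.K) 0) : ℝ)))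
    (hrow : ∀ P : B12.RunParams, ((datumOfRecord₁₃SepCoPHChi F N θ χ h).C P).flow.InInterval γ P.K → ∀ k, k + 1 ≤ P.K → SLaw₁₃CoPHChi F N θ χ P (k + 1) →
      ∀ᵐ U ∂(fieldMeasure (F.P P.K) (k + 1) (SU N)),
        χ P.K (gOfRecord₁₃Chi F N θ.toStage13Params χ P) (k + 1) U *
              Real.exp (-(1 / (gOfRecord₁₃Chi F N θ.toStage13Params χ P (k + 1)) ^ 2 * wilsonBGOfRecord F N θ.εbg P (k + 1) U)
                - em (gOfRecord₁₃Chi F N θ.toStage13Params χ P (k + 1)) * (Fintype.card (Site (F.P P.K) (k + 1)) : ℝ)) ≤ densOfRecord₁₃Chi F N θ.toStage13Params χ P (k + 1) U ∧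
          densOfRecord₁₃Chi F N θ.toStage13Params χ P (k + 1) U ≤ Real.exp (ep (gOfRecord₁₃Chi F N θ.toStage13Params χ P (k + 1)) * (Fintype.card (Site (F.P P.K) (k + 1)) : ℝ))) :
    ∃ ρ' : (P : B12.RunParams) → (k : ℕ) → GaugeField (F.P P.K) k (SU N) → ℝ,
      (∀ P, ρ' P 0 = densOfRecord₁₃Chi F N θ.toStage13Params χ P 0) ∧
        (∀ P k, k < P.K → ρ' P (k + 1) =ᵐ[fieldMeasure (F.P P.K) (k + 1) (SU N)] densOfRecord₁₃Chi F N θ.toStage13Params χ P (k + 1)) ∧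
        B16.EndStatementBPrinted (fun P => { (datumOfRecord₁₃SepCoPHChi F N θ χ h).C P with ρ := ρ' P }) := by
  obtain ⟨ρ', h0, hae, hB⟩ := exists_rho_keep0_ae_eq_endStatementBPrinted_record_of_thm1_of_row0_of_aeRowSucc_chi F N θ χ h hχ1 h1 hγ hrow0 hrow
  exact ⟨ρ', h0, fun P k _ => hae P (k + 1), hB⟩

end RecordChi

/-! ## §2χ. Through the χ-generic VERSION SLOT (`[Ax-3d]` `Revision₁₃Chi ∕ datumOfRecord₁₃SepCoPHVChi`): node00 DEF-1's adapters at χ and the K1-shaped conjunct -/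

section SlotChi

variable (F : T4Family) (N : ℕ) [NeZero N] (θ : Stage13HParams F N) (χ : ChiSlot F N) (h : θ.Provisos₁₃SepCoPHChi F N χ)

/-- **THE ADAPTER at χ** (node00 DEF-1's `Record13SepCoPHV.exists_revision₁₃_of_exists_update` verbatim over `[Ax-3d]`'s slot): SOME explicit density family — equal to the record's at
level `0`, `dV`-a.e. equal at the positive levels the run reads — giving the updated construction a property `Q` ⟹ SOME version `v : Revision₁₃Chi θ χ h` gives the revised χ-datum's
construction the property `Q`. [cite: Balaban1988Convergent, (2.18) p.257, Cor. 3 (2.50) p.264 (bookkeeping)] -/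
theorem exists_revision₁₃Chi_of_exists_update (Q : B16.Construction → Prop)
    (hex : ∃ ρ' : (P : B12.RunParams) → (k : ℕ) → ((datumOfRecord₁₃SepCoPHChi F N θ χ h).C P).Cfg k → ℝ,
      (∀ P : B12.RunParams, ρ' P 0 = ((datumOfRecord₁₃SepCoPHChi F N θ χ h).C P).ρ 0) ∧
        (∀ (P : B12.RunParams) (k : ℕ), k < P.K →
          ρ' P (k + 1) =ᵐ[fieldMeasure (F.P P.K) (k + 1) (SU N)] ((datumOfRecord₁₃SepCoPHChi F N θ χ h).C P).ρ (k + 1)) ∧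
          Q (fun P => { (datumOfRecord₁₃SepCoPHChi F N θ χ h).C P with ρ := ρ' P })) :
    ∃ v : Revision₁₃Chi F N θ χ h, Q (datumOfRecord₁₃SepCoPHVChi F N θ χ h v).C := by
  obtain ⟨ρ', h0, hae, hQ⟩ := hex
  exact ⟨⟨ρ', h0, hae⟩, hQ⟩

/-- The adapter at `Q := B16.EndStatementBPrinted` — the shape of K1ᴬ's revised (B)-conjunct. [cite: Balaban1989LargeFieldII, Thm 1 p.355; Balaban1988Convergent, Cor. 3 (2.50) p.264 (bookkeeping)] -/
theorem exists_revision₁₃Chi_endStatementBPrinted_of_exists_update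
    (hex : ∃ ρ' : (P : B12.RunParams) → (k : ℕ) → ((datumOfRecord₁₃SepCoPHChi F N θ χ h).C P).Cfg k → ℝ,
      (∀ P : B12.RunParams, ρ' P 0 = ((datumOfRecord₁₃SepCoPHChi F N θ χ h).C P).ρ 0) ∧
        (∀ (P : B12.RunParams) (k : ℕ), k < P.K →
          ρ' P (k + 1) =ᵐ[fieldMeasure (F.P P.K) (k + 1) (SU N)] ((datumOfRecord₁₃SepCoPHChi F N θ χ h).C P).ρ (k + 1)) ∧
          B16.EndStatementBPrinted (fun P => { (datumOfRecord₁₃SepCoPHChi F N θ χ h).C P with ρ := ρ' P })) :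
    ∃ v : Revision₁₃Chi F N θ χ h, B16.EndStatementBPrinted (datumOfRecord₁₃SepCoPHVChi F N θ χ h v).C :=
  exists_revision₁₃Chi_of_exists_update F N θ χ h B16.EndStatementBPrinted hex

/-- **★★ THE REVISED (B)-CONJUNCT FROM THE ENGINES' ROW, χ-GENERIC**: Theorem 1 at the χ-datum + the engines' N13 row with «every `U`» at level 0 and «`dV`-a.e. `U`» at levels ≥ 1 (and
`hχ1 : χ ≤ 1`) ⟹ `∃ v : Revision₁₃Chi F N θ χ h, B16.EndStatementBPrinted (datumOfRecord₁₃SepCoPHVChi F N θ χ h v).C`.  The row is a HYPOTHESIS; N13 not discharged.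
[cite: Balaban1989LargeFieldII, Thm 1 + (0.1) pp.355–356; Balaban1988Convergent, Thm 1 p.262, (0.2) p.244, Cor. 3 (2.50) p.264 (bookkeeping)] -/
theorem exists_revision₁₃_endStatementBPrinted_of_thm1_of_row0_of_aeRowSucc_chi
    (hχ1 : ∀ (K : ℕ) (g : ℕ → ℝ) (k : ℕ) (V : GaugeField (F.P K) k (SU N)), χ K g k V ≤ 1)
    (h1 : B16.Thm1Printed (datumOfRecord₁₃SepCoPHChi F N θ χ h).C) {γ : ℝ} (hγ : 0 < γ) {em ep : ℝ → ℝ}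
    (hrow0 : ∀ P : B12.RunParams, ((datumOfRecord₁₃SepCoPHChi F N θ χ h).C P).flow.InInterval γ P.K → SLaw₁₃CoPHChi F N θ χ P 0 →
      ∀ U : GaugeField (F.P P.K) 0 (SU N),
        χ P.K (gOfRecord₁₃Chi F N θ.toStage13Params χ P) 0 U *
              Real.exp (-(1 / (gOfRecord₁₃Chi F N θ.toStage13Params χ P 0) ^ 2 * wilsonBGOfRecord F N θ.εbg P 0 U)
                - em (gOfRecord₁₃Chi F N θ.toStage13Params χ P 0) * (Fintype.card (Site (F.P P.K) 0) : ℝ)) ≤ densOfRecord₁₃Chi F N θ.toStage13Params χ P 0 U ∧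
          densOfRecord₁₃Chi F N θ.toStage13Params χ P 0 U ≤ Real.exp (ep (gOfRecord₁₃Chi F N θ.toStage13Params χ P 0) * (Fintype.card (Site (F.P P.K) 0) : ℝ)))
    (hrow : ∀ P : B12.RunParams, ((datumOfRecord₁₃SepCoPHChi F N θ χ h).C P).flow.InInterval γ P.K → ∀ k, k + 1 ≤ P.K → SLaw₁₃CoPHChi F N θ χ P (k + 1) →
      ∀ᵐ U ∂(fieldMeasure (F.P P.K) (k + 1) (SU N)),
        χ P.K (gOfRecord₁₃Chi F N θ.toStage13Params χ P) (k + 1) U *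
              Real.exp (-(1 / (gOfRecord₁₃Chi F N θ.toStage13Params χ P (k + 1)) ^ 2 * wilsonBGOfRecord F N θ.εbg P (k + 1) U)
                - em (gOfRecord₁₃Chi F N θ.toStage13Params χ P (k + 1)) * (Fintype.card (Site (F.P P.K) (k + 1)) : ℝ)) ≤ densOfRecord₁₃Chi F N θ.toStage13Params χ P (k + 1) U ∧
          densOfRecord₁₃Chi F N θ.toStage13Params χ P (k + 1) U ≤ Real.exp (ep (gOfRecord₁₃Chi F N θ.toStage13Params χ P (k + 1)) * (Fintype.card (Site (F.P P.K) (k + 1)) : ℝ))) :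
    ∃ v : Revision₁₃Chi F N θ χ h, B16.EndStatementBPrinted (datumOfRecord₁₃SepCoPHVChi F N θ χ h v).C :=
  exists_revision₁₃Chi_endStatementBPrinted_of_exists_update F N θ χ h
    (exists_rho_keep0_ae_eq_succGuarded_endStatementBPrinted_record_of_thm1_of_row0_of_aeRowSucc_chi F N θ χ h hχ1 h1 hγ hrow0 hrow)

end SlotChi

/-! ## §3Ax. The instances at the RE-CENTRED cut-off `χ := chiβOfRecord₁₃Ax F N θ.toStage13Params` (the K1ᴬ engine's N13 name) -/

section SlotAx

variable (F : T4Family) (N : ℕ) [NeZero N] (θ : Stage13HParams F N) (h : θ.Provisos₁₃SepCoPHAx F N)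

/-- The re-centred β-slot cut-off is `≤ 1` (`[Ax-2]`: it takes the values `0`, `1` only). [cite: Balaban1987RG1, (2.9) p.266 with (2.3) p.265 (bookkeeping)] -/
theorem chiβOfRecord₁₃Ax_le_one (K : ℕ) (g : ℕ → ℝ) (k : ℕ) (V : GaugeField (F.P K) k (SU N)) :
    chiβOfRecord₁₃Ax F N θ.toStage13Params K g k V ≤ 1 := by
  rcases chiFixed29Ax_eq_zero_or_one (F := F) (N := N) θ.ν θ.ε₂₉ K g k V with h0 | h1
  · rw [show chiβOfRecord₁₃Ax F N θ.toStage13Params K g k V = chiFixed29Ax F N θ.ν θ.ε₂₉ K g k V from rfl, h0]; exact zero_le_one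
  · rw [show chiβOfRecord₁₃Ax F N θ.toStage13Params K g k V = chiFixed29Ax F N θ.ν θ.ε₂₉ K g k V from rfl, h1]

/-- **★★★ THE K1ᴬ ENGINE's N13 NAME — THE REVISED (B)-CONJUNCT AT THE RE-CENTRED RECORD FROM THE ENGINES' ROW**: Theorem 1 at `datumOfRecord₁₃SepCoPHAx θ h` + the N13 row (2.50) over the
re-centred letters (`chiβOfRecord₁₃Ax`, `gOfRecord₁₃Chi … (chiβOfRecord₁₃Ax …)`, `densOfRecord₁₃Chi … (chiβOfRecord₁₃Ax …)`, guard `SLaw₁₃CoPHChi … (chiβOfRecord₁₃Ax …)`) with «every `U`»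
at level 0 and «`dV`-a.e. `U`» at levels ≥ 1 ⟹ `∃ v : Revision₁₃Ax F N θ h, B16.EndStatementBPrinted (datumOfRecord₁₃SepCoPHVAx F N θ h v).C` — the (B)-slot of K1ᴬ
`StabilityBRunRowsAtRecordR13SepCoPHVAx` AS TYPED.  The row is a HYPOTHESIS; N13 not discharged; K1ᴬ not claimed.
[cite: Balaban1989LargeFieldII, Thm 1 + (0.1) pp.355–356; Balaban1988Convergent, Thm 1 p.262, Cor. 3 (2.50) p.264; Balaban1987RG1, (2.9) p.266 with (2.3) p.265 (bookkeeping)] -/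
theorem exists_revision₁₃Ax_endStatementBPrinted_of_thm1_of_row0_of_aeRowSucc
    (h1 : B16.Thm1Printed (datumOfRecord₁₃SepCoPHAx F N θ h).C) {γ : ℝ} (hγ : 0 < γ) {em ep : ℝ → ℝ}
    (hrow0 : ∀ P : B12.RunParams, ((datumOfRecord₁₃SepCoPHAx F N θ h).C P).flow.InInterval γ P.K →
      SLaw₁₃CoPHChi F N θ (chiβOfRecord₁₃Ax F N θ.toStage13Params) P 0 →
      ∀ U : GaugeField (F.P P.K) 0 (SU N),
        chiβOfRecord₁₃Ax F N θ.toStage13Params P.K (gOfRecord₁₃Ax F N θ.toStage13Params P) 0 U *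
              Real.exp (-(1 / (gOfRecord₁₃Ax F N θ.toStage13Params P 0) ^ 2 * wilsonBGOfRecord F N θ.εbg P 0 U)
                - em (gOfRecord₁₃Ax F N θ.toStage13Params P 0) * (Fintype.card (Site (F.P P.K) 0) : ℝ)) ≤
            densOfRecord₁₃Chi F N θ.toStage13Params (chiβOfRecord₁₃Ax F N θ.toStage13Params) P 0 U ∧
          densOfRecord₁₃Chi F N θ.toStage13Params (chiβOfRecord₁₃Ax F N θ.toStage13Params) P 0 U ≤
            Real.exp (ep (gOfRecord₁₃Ax F N θ.toStage13Params P 0) * (Fintype.card (Site (F.P P.K) 0) : ℝ)))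
    (hrow : ∀ P : B12.RunParams, ((datumOfRecord₁₃SepCoPHAx F N θ h).C P).flow.InInterval γ P.K → ∀ k, k + 1 ≤ P.K →
      SLaw₁₃CoPHChi F N θ (chiβOfRecord₁₃Ax F N θ.toStage13Params) P (k + 1) →
      ∀ᵐ U ∂(fieldMeasure (F.P P.K) (k + 1) (SU N)),
        chiβOfRecord₁₃Ax F N θ.toStage13Params P.K (gOfRecord₁₃Ax F N θ.toStage13Params P) (k + 1) U *
              Real.exp (-(1 / (gOfRecord₁₃Ax F N θ.toStage13Params P (k + 1)) ^ 2 * wilsonBGOfRecord F N θ.εbg P (k + 1) U)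
                - em (gOfRecord₁₃Ax F N θ.toStage13Params P (k + 1)) * (Fintype.card (Site (F.P P.K) (k + 1)) : ℝ)) ≤
            densOfRecord₁₃Chi F N θ.toStage13Params (chiβOfRecord₁₃Ax F N θ.toStage13Params) P (k + 1) U ∧
          densOfRecord₁₃Chi F N θ.toStage13Params (chiβOfRecord₁₃Ax F N θ.toStage13Params) P (k + 1) U ≤
            Real.exp (ep (gOfRecord₁₃Ax F N θ.toStage13Params P (k + 1)) * (Fintype.card (Site (F.P P.K) (k + 1)) : ℝ))) :
    ∃ v : Revision₁₃Ax F N θ h, B16.EndStatementBPrinted (datumOfRecord₁₃SepCoPHVAx F N θ h v).C :=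
  exists_revision₁₃_endStatementBPrinted_of_thm1_of_row0_of_aeRowSucc_chi F N θ (chiβOfRecord₁₃Ax F N θ.toStage13Params) h (chiβOfRecord₁₃Ax_le_one F N θ)
    h1 hγ hrow0 hrow

end SlotAx

end Summit.QuantumFields.YangMills.BalabanUVNodes.N13Cor3AEKeepZeroOfEnginesRowAtRecord13Chi

end
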